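import Mathlib
import Summits.NavierStokesRegularity.NavierStokesRegularity.Theses.PlaneEnergyCeiling
import Summits.NavierStokesRegularity.NavierStokesRegularity.Theorems.PlaneEnergyCeilingSlabEnergyIdentityPointwise
import Summits.NavierStokesRegularity.NavierStokesRegularity.Theorems.PlaneEnergyCeilingPlanarEnergyAPrioriPlanarAgmon

/-!
# Route PlaneEnergyCeiling · support `ScaledEnergyOfPlanar` — planar ceiling ⇒ scaled-energy ceiling

Support item stmt-NavierStokesRegularity-16860 of route `PlaneEnergyCeiling` (the FREE STRUCTURE of
the crux `PlanarEnergyAPriori`, stmt-NavierStokesRegularity-16855): if a continuous field `w` on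
`ℝ³` has planar energy `≤ M` through every plane `R({x₂ = c})`, then
`∫_{B_r(x₀)} |w|² ≤ 2 r M` for every centre and radius — the ball lies in the slab
`|x₂ − (x₀)₂| < r`, and by Tonelli along the coordinate foliation
(`lintegral_eq_lintegral_lintegral_normalLine` of the planar Agmon file) the slab energy is the
`c`-integral of the planar energies over an interval of length `2r`. Hence a planar ceiling along a
solution is a uniform bound on the Caffarelli–Kohn–Nirenberg scaled energy
`sup_{x,r} r⁻¹∫_{B_r(x)}|u|² ≤ 2M` (Seregin's Type-I-in-energy class; the hypothesis of Choe–Yang's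
reverse Hölder theorem). Elementary measure theory; Mathlib + the route's Tonelli lemma.
-/

noncomputable section

-- single-conjunct summit: `Summit.<Summit>.<Problem>` repeats the name by the D-0017 layout
set_option linter.dupNamespace false

namespace Summit.NavierStokesRegularity.NavierStokesRegularity.Theorems.PlanarEnergyAPriori

open MeasureTheory Set Filter Topology WithLp Metric
open scoped ENNReal
open Summit.NavierStokesRegularity.NavierStokesRegularity.Theorems.PlaneEnergyCeilingSlabEnergyIdentity

/-- A ball lies in the coordinate slab of the same radius about its centre:
`‖x − x₀‖ < r ⇒ (x₀)₂ − r < x₂ < (x₀)₂ + r`. -/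
theorem ball_subset_slab (x₀ : EuclideanSpace ℝ (Fin 3)) (r : ℝ) :
    ball x₀ r ⊆ {x : EuclideanSpace ℝ (Fin 3) | x₀ 2 - r < x 2 ∧ x 2 < x₀ 2 + r} := by
  intro x hx
  rw [mem_ball, dist_eq_norm] at hx
  have h1 : |x 2 - x₀ 2| ≤ ‖x - x₀‖ := by
    have := norm_apply_le_norm (x - x₀) 2
    simpa [Real.norm_eq_abs] using this
  have h2 := (abs_lt.1 (h1.trans_lt hx))
  exact ⟨by linarith [h2.1], by linarith [h2.2]⟩

/-- **Slab energy from planar energies.** For a continuous field `w` with planar energies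
`≤ M'` (in `ℝ≥0∞`) through every coordinate plane `{x₂ = c}`, the energy in the slab
`{a < x₂ < b}` is at most `(b − a)₊ M'`: Tonelli along the coordinate foliation. -/
theorem lintegral_slab_le_of_planar {F : Type*} [NormedAddCommGroup F] {w : EuclideanSpace ℝ (Fin 3) → F}
    (hw : Continuous w) {M' : ℝ≥0∞}
    (hpl : ∀ c : ℝ, ∫⁻ y : EuclideanSpace ℝ (Fin 2), ‖w (toLp 2 ![y 0, y 1, c])‖ₑ ^ 2 ≤ M') (a b : ℝ) :
    ∫⁻ x in {x : EuclideanSpace ℝ (Fin 3) | a < x 2 ∧ x 2 < b}, ‖w x‖ₑ ^ 2 ≤ ENNReal.ofReal (b - a) * M' := by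
  set S : Set (EuclideanSpace ℝ (Fin 3)) := {x | a < x 2 ∧ x 2 < b} with hS
  have hSm : MeasurableSet S := measurableSet_slab a b
  set f : EuclideanSpace ℝ (Fin 3) → ℝ≥0∞ := S.indicator fun x => ‖w x‖ₑ ^ 2 with hf
  have hfm : Measurable f :=
    ((continuous_enorm.comp hw).measurable.pow_const 2).indicator hSm
  -- the indicator along the normal lines is the indicator of the interval `(a, b)`
  have hline : ∀ (y : EuclideanSpace ℝ (Fin 2)) (s : ℝ),
      f (toLp 2 ![y 0, y 1, s]) = (Ioo a b).indicator (fun s => ‖w (toLp 2 ![y 0, y 1, s])‖ₑ ^ 2) s := by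
    intro y s
    by_cases hs : s ∈ Ioo a b
    · rw [hf, indicator_of_mem (show (toLp 2 ![y 0, y 1, s] : EuclideanSpace ℝ (Fin 3)) ∈ S from hs),
        indicator_of_mem hs]
    · rw [hf, indicator_of_notMem (show (toLp 2 ![y 0, y 1, s] : EuclideanSpace ℝ (Fin 3)) ∉ S from hs),
        indicator_of_notMem hs]
  have hmeas2 : Measurable fun q : EuclideanSpace ℝ (Fin 2) × ℝ => ‖w (toLp 2 ![q.1 0, q.1 1, q.2])‖ₑ ^ 2 := by
    have hc : Continuous fun q : EuclideanSpace ℝ (Fin 2) × ℝ => (toLp 2 ![q.1 0, q.1 1, q.2] : EuclideanSpace ℝ (Fin 3)) := by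
      fun_prop
    exact (continuous_enorm.comp (hw.comp hc)).measurable.pow_const 2
  calc ∫⁻ x in S, ‖w x‖ₑ ^ 2 = ∫⁻ x, f x := (lintegral_indicator hSm _).symm
    _ = ∫⁻ y : EuclideanSpace ℝ (Fin 2), ∫⁻ s : ℝ, f ((LinearIsometryEquiv.refl ℝ (EuclideanSpace ℝ (Fin 3))) (toLp 2 ![y 0, y 1, s])) :=
        lintegral_eq_lintegral_lintegral_normalLine hfm (LinearIsometryEquiv.refl ℝ _)
    _ = ∫⁻ y : EuclideanSpace ℝ (Fin 2), ∫⁻ s in Ioo a b, ‖w (toLp 2 ![y 0, y 1, s])‖ₑ ^ 2 := by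
        simp only [LinearIsometryEquiv.coe_refl, id_eq, hline, lintegral_indicator measurableSet_Ioo]
    _ = ∫⁻ s in Ioo a b, ∫⁻ y : EuclideanSpace ℝ (Fin 2), ‖w (toLp 2 ![y 0, y 1, s])‖ₑ ^ 2 := by
        rw [lintegral_lintegral_swap]
        exact hmeas2.aemeasurable
    _ ≤ ∫⁻ _ in Ioo a b, M' := setLIntegral_mono' measurableSet_Ioo fun s _ => hpl s
    _ = ENNReal.ofReal (b - a) * M' := by rw [setLIntegral_const, Real.volume_Ioo, mul_comm]

/-- **Ball energy from planar energies.** For a continuous field `w` with planar energies `≤ M'`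
through every coordinate plane `{x₂ = c}`: `∫_{B_r(x₀)} ‖w‖ₑ² ≤ 2r · M'` (the ball lies in the slab
`|x₂ − (x₀)₂| < r`). -/
theorem lintegral_ball_le_of_planar {F : Type*} [NormedAddCommGroup F] {w : EuclideanSpace ℝ (Fin 3) → F}
    (hw : Continuous w) {M' : ℝ≥0∞}
    (hpl : ∀ c : ℝ, ∫⁻ y : EuclideanSpace ℝ (Fin 2), ‖w (toLp 2 ![y 0, y 1, c])‖ₑ ^ 2 ≤ M')
    (x₀ : EuclideanSpace ℝ (Fin 3)) (r : ℝ) :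
    ∫⁻ x in ball x₀ r, ‖w x‖ₑ ^ 2 ≤ ENNReal.ofReal (2 * r) * M' := by
  calc ∫⁻ x in ball x₀ r, ‖w x‖ₑ ^ 2
      ≤ ∫⁻ x in {x : EuclideanSpace ℝ (Fin 3) | x₀ 2 - r < x 2 ∧ x 2 < x₀ 2 + r}, ‖w x‖ₑ ^ 2 :=
        lintegral_mono_set (ball_subset_slab x₀ r)
    _ ≤ ENNReal.ofReal ((x₀ 2 + r) - (x₀ 2 - r)) * M' := lintegral_slab_le_of_planar hw hpl _ _
    _ = ENNReal.ofReal (2 * r) * M' := by congr 2; ring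

/-- **`ScaledEnergyOfPlanar` — the route support item stmt-NavierStokesRegularity-16860 BY NAME**
(PLANAR CEILING ⇒ SCALED-ENERGY CEILING): if a continuous field `w` on `ℝ³` has planar energy
`≤ M` through every plane `R({x₂ = c})`, then `∫_{B_r(x₀)}|w|² ≤ 2rM` for every centre `x₀` and
radius `r > 0` (only the coordinate foliation `R = 1` is used). Hence bounded planar energy along a
solution means a uniformly bounded Caffarelli–Kohn–Nirenberg scaled energy
`sup_{x,r} r⁻¹∫_{B_r(x)}|u|² ≤ 2M` — Seregin's Type-I-in-energy class. [folklore] -/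
theorem planeEnergyCeiling_scaledEnergyOfPlanar :
    Summit.NavierStokesRegularity.NavierStokesRegularity.Theses.PlaneEnergyCeiling.ScaledEnergyOfPlanar := by
  intro w hw M hM hpl x₀ r hr
  have hpl' : ∀ c : ℝ, ∫⁻ y : EuclideanSpace ℝ (Fin 2), ‖w (toLp 2 ![y 0, y 1, c])‖ₑ ^ 2 ≤ ENNReal.ofReal M :=
    fun c => by simpa using hpl (LinearIsometryEquiv.refl ℝ _) c
  calc ∫⁻ x in ball x₀ r, ‖w x‖ₑ ^ 2 ≤ ENNReal.ofReal (2 * r) * ENNReal.ofReal M :=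
        lintegral_ball_le_of_planar hw hpl' x₀ r
    _ = ENNReal.ofReal (2 * r * M) := by rw [← ENNReal.ofReal_mul (by positivity)]

end Summit.NavierStokesRegularity.NavierStokesRegularity.Theorems.PlanarEnergyAPriori

end
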